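import Mathlib
import Summits.Ventures.PercRepro2.ThreeTermInstanceHOBAll
import Summits.Ventures.PercRepro2.ThreeTermInstanceS4C212

/-!
# Three-terminal parts, V g: ROW 2′TRI ON THE CORE `S4C212` PLUS EVERY THREE-TERMINAL PART, WITH INERT EDGES
(blind cell PercRepro2, night-3 g31, 2026-08-30; `proofs/NIGHT3-CERT.md` §40; GENERATED by
mining/night-3/g31/inst/mkuniversal_inert.py — the template is ThreeTermInstanceHOBAll.lean of g30)

The core `S4C212` (core edges with types [(0, 2, 2), (2, 3, 1), (3, 1, 2)] on the marks `l h o b a₃ = 0 1 2 3 4`, terminal triple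
(0, 1, 4)) has its partition table evaluated in the kernel and certified (ThreeTermInstanceS4C212.lean);
along the embedding of the model part graph into the part graph of any instance made of the core and
an unmarked three-terminal part `Γ` at the terminals (ThreeTermTransport.lean) the instance's table is
the model's, so **`typedCount_nonneg_S4C212_part_inert`**: row 2′TRI holds on EVERY graph that contains
`S4C212 + Γ` for a part `Γ` — any size, any type map on `Γ`, any pinning — and whose other edges (the
INERT edges: anywhere outside the part, marks included) are pinned closed; g30's `hcover` (no other
edge at all) is replaced by `hinert`.  Own work; standard axioms.
-/

namespace Summit.Ventures.PercRepro2

open TypedStar Part ThreeTerm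

namespace InstS4C212

section All

variable {V E : Type} [Fintype E] [DecidableEq E]

set_option maxHeartbeats 1000000 in
/-- **ROW 2′TRI ON THE CORE `S4C212` PLUS ANY THREE-TERMINAL PART, THE OTHER EDGES PINNED CLOSED.** -/
theorem typedCount_nonneg_S4C212_part_inert (ends : E → Sym2 V) (l h o b a₃ : V) (ec0 ec1 ec2 : E) (W : Set V)
    (S : Finset E) (e₁ e₂ e₃ : E)
    (hlh : l ≠ h) (hlo : l ≠ o) (hlb : l ≠ b) (hla : l ≠ a₃) (hho : h ≠ o) (hhb : h ≠ b) (hha : h ≠ a₃)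
    (hob : o ≠ b) (hoa : o ≠ a₃) (hba : b ≠ a₃)
    (hends0 : ends ec0 = s(l, o)) (hends1 : ends ec1 = s(o, b)) (hends2 : ends ec2 = s(b, h)) (hne01 : ec0 ≠ ec1) (hne02 : ec0 ≠ ec2) (hne12 : ec1 ≠ ec2)
    (hW : IsPart ends W l h a₃) (hS : ∀ e, e ∈ S ↔ e ∈ touches ends W)
    (hl : l ∉ W) (hh : h ∉ W) (ho : o ∉ W) (hb : b ∉ W) (ha : a₃ ∉ W)
    (h1 : e₁ ∈ S) (h2 : e₂ ∈ S) (h3 : e₃ ∈ S) (h12 : e₁ ≠ e₂) (h13 : e₁ ≠ e₃) (h23 : e₂ ≠ e₃)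
    (z : Config E) (τ : E → ℕ) (hτ0 : τ ec0 = 2) (hτ1 : τ ec1 = 1) (hτ2 : τ ec2 = 2)
    (hinert : ∀ e, e ∉ S → e ∉ ({ec0, ec1, ec2} : Finset E) → z e = false) :
    0 ≤ typedCount ({ec0, ec1, ec2} ∪ S) z τ (CovForm.K3 (R := ℚ) ends o l h a₃ b) := by
  have hec0S : ec0 ∉ S := by
    rw [hS]
    rintro ⟨x, hx, y, hxy⟩
    rw [hends0, Sym2.eq_iff] at hxy
    rcases hxy with ⟨rfl, -⟩ | ⟨-, rfl⟩
    · exact hl hx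
    · exact ho hx
  have hec1S : ec1 ∉ S := by
    rw [hS]
    rintro ⟨x, hx, y, hxy⟩
    rw [hends1, Sym2.eq_iff] at hxy
    rcases hxy with ⟨rfl, -⟩ | ⟨-, rfl⟩
    · exact ho hx
    · exact hb hx
  have hec2S : ec2 ∉ S := by
    rw [hS]
    rintro ⟨x, hx, y, hxy⟩
    rw [hends2, Sym2.eq_iff] at hxy
    rcases hxy with ⟨rfl, -⟩ | ⟨-, rfl⟩
    · exact hb hx
    · exact hh hx
  have m0 : ec0 ∈ ({ec0, ec1, ec2} : Finset E) := by simp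
  have m1 : ec1 ∈ ({ec0, ec1, ec2} : Finset E) := by simp
  have m2 : ec2 ∈ ({ec0, ec1, ec2} : Finset E) := by simp
  -- a vertex of the part
  obtain ⟨w₀, hw₀, -⟩ := (hS e₁).1 h1
  have hw₀l : w₀ ≠ l := fun h => hl (h ▸ hw₀)
  have hw₀h : w₀ ≠ h := fun h' => hh (h' ▸ hw₀)
  have hw₀o : w₀ ≠ o := fun h => ho (h ▸ hw₀)
  have hw₀b : w₀ ≠ b := fun h => hb (h ▸ hw₀)
  have hw₀a : w₀ ≠ a₃ := fun h => ha (h ▸ hw₀)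
  set ends' := partEnds ends (↑S) e₁ e₂ e₃ l h a₃ with hends'
  have hn03 : ec0 ≠ e₁ := fun h => hec0S (h ▸ h1)
  have hn04 : ec0 ≠ e₂ := fun h => hec0S (h ▸ h2)
  have hn05 : ec0 ≠ e₃ := fun h => hec0S (h ▸ h3)
  have hn13 : ec1 ≠ e₁ := fun h => hec1S (h ▸ h1)
  have hn14 : ec1 ≠ e₂ := fun h => hec1S (h ▸ h2)
  have hn15 : ec1 ≠ e₃ := fun h => hec1S (h ▸ h3)
  have hn23 : ec2 ≠ e₁ := fun h => hec2S (h ▸ h1)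
  have hn24 : ec2 ≠ e₂ := fun h => hec2S (h ▸ h2)
  have hn25 : ec2 ≠ e₃ := fun h => hec2S (h ▸ h3)
  let φ : PartEmbed pg ends' :=
    { ν := InstHOB.ν l h o b a₃ w₀
      ι := ![ec0, ec1, ec2, e₁, e₂, e₃]
      ν_inj := by
        intro i j hij
        fin_cases i <;> fin_cases j <;> simp_all [InstHOB.ν]
      ι_inj := by
        intro i j hij
        fin_cases i <;> fin_cases j <;> simp_all
      ends_eq := by
        intro i
        fin_cases i
        · show partEnds ends (↑S) e₁ e₂ e₃ l h a₃ ec0 = Sym2.map (InstHOB.ν l h o b a₃ w₀) s(0, 2)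
          rw [partEnds_apply_of_notMem ends (↑S) l h a₃ h1 h2 h3 hec0S, hends0]
          rfl
        · show partEnds ends (↑S) e₁ e₂ e₃ l h a₃ ec1 = Sym2.map (InstHOB.ν l h o b a₃ w₀) s(2, 3)
          rw [partEnds_apply_of_notMem ends (↑S) l h a₃ h1 h2 h3 hec1S, hends1]
          rfl
        · show partEnds ends (↑S) e₁ e₂ e₃ l h a₃ ec2 = Sym2.map (InstHOB.ν l h o b a₃ w₀) s(3, 1)
          rw [partEnds_apply_of_notMem ends (↑S) l h a₃ h1 h2 h3 hec2S, hends2]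
          rfl
        · show partEnds ends (↑S) e₁ e₂ e₃ l h a₃ e₁ = Sym2.map (InstHOB.ν l h o b a₃ w₀) s(0, 1)
          rw [partEnds_apply_1]
          rfl
        · show partEnds ends (↑S) e₁ e₂ e₃ l h a₃ e₂ = Sym2.map (InstHOB.ν l h o b a₃ w₀) s(0, 4)
          rw [partEnds_apply_2 ends (↑S) l h a₃ h12]
          rfl
        · show partEnds ends (↑S) e₁ e₂ e₃ l h a₃ e₃ = Sym2.map (InstHOB.ν l h o b a₃ w₀) s(1, 4)
          rw [partEnds_apply_3 ends (↑S) l h a₃ h13 h23]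
          rfl
        }
  -- the typed edges of the instance are the image of the model's
  have hF : ({ec0, ec1, ec2} : Finset E) = Finset.map ⟨φ.ι, φ.ι_inj⟩ InstS4C212.F := by
    ext e
    simp only [Finset.mem_insert, Finset.mem_singleton, Finset.mem_map, Function.Embedding.coeFn_mk]
    constructor
    · rintro (rfl | rfl | rfl)
      · exact ⟨0, by decide, rfl⟩
      · exact ⟨1, by decide, rfl⟩
      · exact ⟨2, by decide, rfl⟩
    · rintro ⟨i, hi, rfl⟩
      have hi' : i = 0 ∨ i = 1 ∨ i = 2 := by
        revert hi
        change i ∈ ({0, 1, 2} : Finset (Fin 6)) → _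
        simp
      rcases hi' with rfl | rfl | rfl
      · exact Or.inl rfl
      · exact Or.inr (Or.inl rfl)
      · exact Or.inr (Or.inr (rfl))
  -- the pins of the instance's table are the extensions of the model's pins (off the typed edges)
  have hpin : ∀ (p : Fin 5) (e : E), e ∉ ({ec0, ec1, ec2} : Finset E) →
      setOn S (cfg e₁ e₂ e₃ (rep5 p)) z e = ext φ (pin p) e := by
    intro p e he
    by_cases heS : e ∈ S
    swap
    · rw [setOn_of_not_mem heS, hinert e heS he]
      have hoff : ∀ i : Fin 6, φ.ι i ≠ e := by
        intro i
        fin_cases i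
        · exact fun h' => he (h' ▸ m0)
        · exact fun h' => he (h' ▸ m1)
        · exact fun h' => he (h' ▸ m2)
        · exact fun h' => heS (h' ▸ h1)
        · exact fun h' => heS (h' ▸ h2)
        · exact fun h' => heS (h' ▸ h3)
      rw [ext_off φ (pin p) hoff]
    rw [setOn_of_mem heS]
    by_cases k1 : e = e₁
    · rw [k1]
      have : ext φ (pin p) e₁ = pin p 3 := ext_ι φ (pin p) 3
      rw [this]
      simp [cfg, pin, setOn, InstS4C212.S]
    by_cases k2 : e = e₂
    · rw [k2]
      have : ext φ (pin p) e₂ = pin p 4 := ext_ι φ (pin p) 4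
      rw [this]
      simp [cfg, pin, setOn, InstS4C212.S, h12.symm]
    by_cases k3 : e = e₃
    · rw [k3]
      have : ext φ (pin p) e₃ = pin p 5 := ext_ι φ (pin p) 5
      rw [this]
      simp [cfg, pin, setOn, InstS4C212.S, h13.symm, h23.symm]
    · have hoff : ∀ i : Fin 6, φ.ι i ≠ e := by
        intro i
        fin_cases i
        · exact fun h' => he (h' ▸ m0)
        · exact fun h' => he (h' ▸ m1)
        · exact fun h' => he (h' ▸ m2)
        · exact fun h' => k1 h'.symm
        · exact fun h' => k2 h'.symm
        · exact fun h' => k3 h'.symm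
      rw [ext_off φ (pin p) hoff]
      simp [cfg, k1, k2, k3]
  -- the instance's table is the model's table
  have hτF : ∀ e ∈ InstS4C212.F, τ (φ.ι e) = τ₀ e := by
    intro e he
    have he' : e = 0 ∨ e = 1 ∨ e = 2 := by
      revert he
      change e ∈ ({0, 1, 2} : Finset (Fin 6)) → _
      simp
    rcases he' with rfl | rfl | rfl
    · exact hτ0
    · exact hτ1
    · exact hτ2
  have htab : ∀ p q r, partTable5 ends S e₁ e₂ e₃ l h a₃ o l h a₃ b {ec0, ec1, ec2} z τ p q r = (tbl5 p q r : ℚ) := by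
    intro p q r
    rw [← partTable5_eq p q r]
    unfold partTable5 partTable
    rw [partEnds_eq]
    rw [InstHOB.typedCount3_congr_pins {ec0, ec1, ec2} (hpin p) (hpin q) (hpin r) τ _]
    rw [hF, typedCount3_ext φ InstS4C212.F (pin p) (pin q) (pin r) hτF]
    show typedCount3 InstS4C212.F (pin p) (pin q) (pin r) τ₀ _ =
      typedCount3 InstS4C212.F (pin p) (pin q) (pin r) τ₀ (CovForm.K3 (R := ℚ) pg 2 0 1 4 3)
    congr 1
    funext x y w
    exact (K3_ext φ 2 0 1 4 3 x y w).symm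
  -- the certificate transports
  have hcone : InCone (fun ν' => ∑ p : Fin 5, ∑ q : Fin 5, ∑ r : Fin 5,
      partTable5 ends S e₁ e₂ e₃ l h a₃ o l h a₃ b {ec0, ec1, ec2} z τ p q r * mono p q r ν') := by
    have e : (fun ν' => ∑ p : Fin 5, ∑ q : Fin 5, ∑ r : Fin 5,
        partTable5 ends S e₁ e₂ e₃ l h a₃ o l h a₃ b {ec0, ec1, ec2} z τ p q r * mono p q r ν') =
        (fun ν' => ∑ p : Fin 5, ∑ q : Fin 5, ∑ r : Fin 5,
        partTable5 InstS4C212.ends InstS4C212.S 3 4 5 0 1 4 2 0 1 4 3 InstS4C212.F z₀ τ₀ p q r * mono p q r ν') := by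
      funext ν'
      simp only [htab, partTable5_eq]
    rw [e]
    exact inCone_S4C212
  have hd : Disjoint ({ec0, ec1, ec2} : Finset E) S := by
    rw [Finset.disjoint_left]
    intro e he
    simp only [Finset.mem_insert, Finset.mem_singleton] at he
    rcases he with rfl | rfl | rfl
    · exact hec0S
    · exact hec1S
    · exact hec2S
  exact typedCount_part_nonneg_of_inCone5' (ends := ends) (W := W) (t₁ := l) (t₂ := h) (t₃ := a₃) hW
    (S := S) hS (e₁ := e₁) (e₂ := e₂) (e₃ := e₃) h1 h2 h3 h12 h13 h23 (o := o) (a₁ := l) (a₂ := h)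
    (a₃ := a₃) (b := b) ho hl hh ha hb (F := {ec0, ec1, ec2}) hd z τ hcone

end All

end InstS4C212

end Summit.Ventures.PercRepro2

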